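import Summits.ValiantsHypothesis.ValiantsHypothesis.Theorems.GrenetZeonDualUnipotentThreeHalvesHeavyTopThmCIdentities
import Summits.ValiantsHypothesis.ValiantsHypothesis.Theorems.GrenetZeonDualUnipotentThreeHalvesHeavyTopThmCLinAlg

/-!
# `GrenetZeon.DualUnipotentThreeHalves` (stmt-ValiantsHypothesis-24318), R2 heavy-top instrument — UNIFORM THEOREM C, FILE 4:
# THEOREM B (the deficient height is `s` or `2s`) and LEMMA R-a (`h⋆ = s ≥ 2` is impossible), uniform in `n`

Experiment cell «val-heavytop-census» (D-0160), engine seat val-htc-eng-1 g5.  In the frame of the Thm C(n) ports (graded nilpotent `W ∋ J`, `P_h = W.map (dp h)`,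
`N_h = W.map (dm h)`; ✓ `…ThmCnGradedCount`, ✓ `…ThmCnStructure`) with `s` the lowest weight (`N_s ≠ 0`, `N_h = 0` for `h > s`):

* ★ `theoremB` — if `J^s ∈ W` and `c_b c_{b+s} ≡ 0` on `N_s` (e.g. `T_{2s} ⊆ W`, (T3)) then `N_s = 0`: the memo's THEOREM B «`h⋆ ∈ {s, 2s}`» by the
  (P)-lemma ✓ `pair_eq_zero_of_isNilpotent_band` with `x = 𝟙`;
* `zeroSum_mem_of_count` — the support count of LEMMA R-a (i): if `P` vanishes on the joint support `S` of `N`, members of `N` have zero sum,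
  and `dim P + dim N ≥ N₀ − 1`, then `N` contains EVERY zero-sum vector supported on `S`;
* ★ `lemmaRa` — `h⋆ = s ≥ 2` is impossible: `e_a − e_b ∈ N_s` for some `a < b`; its window vector `C = 𝟙_{[a,a+s)} − 𝟙_{[b,b+s)}` lies in `N_1` (T1);
  for `b ≤ a + s` the mixed word (T2) at `i = a` reads `−[b = a+1] − 1 = 0`, and for `b > a + s` the second-order identity
  `Σ C_k² + 2 Σ C_k C_{k+1} = 6s − 4 = 0` (✓ `sum_sq_add_two_mul_sum_eq_zero` with `J`) — both absurd.  (The memo kills all cases by the continuant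
  value `e₂^{na}(C) = −(3d−2) + [g = 0]`; the kernel route splits `D ≤ s` / `D > s` to keep the evaluation trivial.)

Honest framing: infrastructure for the uniform Thm C; nothing here proves or refutes `HeavyTopLaw`/`HeavyTopSlowLaw`, 24318, S3 or 8062; `VP ≠ VNP` is NOT proved.
No definitions.  [val-idea-30 MEMO codim-one THEOREM B, §2 LEMMA R-a; this seat]
-/

noncomputable section

-- single-conjunct layout: Sub = Summit, duplicated namespace component intended
set_option linter.dupNamespace false

namespace Summit.ValiantsHypothesis.ValiantsHypothesis.Theorems.GrenetZeon.HeavyTopThmCLemmaRa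

open Matrix
open Summit.ValiantsHypothesis.ValiantsHypothesis.Theorems.GrenetZeon.HeavyTopThmCBandCalculus
  (pair_eq_zero_of_isNilpotent_band sum_sq_add_two_mul_sum_eq_zero)
open Summit.ValiantsHypothesis.ValiantsHypothesis.Theorems.GrenetZeon.HeavyTopThmCIdentities
  (upper_band_mem sq_eq_zero_of_unit_mem window_lower_mem mixed_word sum_ite_eq_val)
open Summit.ValiantsHypothesis.ValiantsHypothesis.Theorems.GrenetZeon.HeavyTopThmCnStructure (lower_band_mem)

variable {n : ℕ}

/-! ## Two small conversions -/

/-- The matrix unit `E_{i,i+h}` as an upper band. -/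
theorem unit_eq_upperBand (i h : ℕ) :
    (Matrix.of fun a b : Fin n => if (a : ℕ) = i ∧ (b : ℕ) = i + h then (1 : ℂ) else 0) =
      Matrix.of fun a b : Fin n => if (b : ℕ) = (a : ℕ) + h then (fun a : Fin n => if (a : ℕ) = i then (1 : ℂ) else 0) a else 0 := by
  ext a b; simp only [Matrix.of_apply]
  by_cases ha : (a : ℕ) = i
  · by_cases hb : (b : ℕ) = (a : ℕ) + h
    · rw [if_pos ⟨ha, by omega⟩, if_pos hb, if_pos ha]
    · rw [if_neg (fun h' => hb (by omega)), if_neg hb]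
  · rw [if_neg (fun h' => ha h'.1)]; split_ifs <;> rfl

/-- Counting an interval inside `Fin n`: `Σ_k [l ≤ k < u] = u − l` for `l ≤ u ≤ n`. -/
theorem sum_indicator_eq (l u : ℕ) (hu : u ≤ n) :
    (∑ k : Fin n, if l ≤ (k : ℕ) ∧ (k : ℕ) < u then (1 : ℂ) else 0) = ((u - l : ℕ) : ℂ) := by
  classical
  rw [Fin.sum_univ_eq_sum_range (fun k => if l ≤ k ∧ k < u then (1 : ℂ) else 0) n, Finset.sum_boole]
  congr 1
  have : (Finset.range n).filter (fun k => l ≤ k ∧ k < u) = Finset.Ico l u := by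
    ext k; simp only [Finset.mem_filter, Finset.mem_range, Finset.mem_Ico]; omega
  rw [this, Nat.card_Ico]

/-! ## THEOREM B -/

/-- ★ **THEOREM B (kernel form).**  If `J^s ∈ W` (`s ≥ 1`), `L_s(c) ∈ W` and `c_{b+s} c_b = 0` for all `b`, then `c_a = 0` for every `a` with `a + s < n`
(the (P)-lemma with `x = 𝟙`).  In the memo's words: the lowest weight `s` of the graded limit must be the deficient height or half of it.
[memo §1 THEOREM B; this seat] -/
theorem theoremB (W : Submodule ℂ (Matrix (Fin n) (Fin n) ℂ)) (hW : ∀ A ∈ W, IsNilpotent A) {s : ℕ} (hs : 1 ≤ s) (c : Fin n → ℂ)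
    (hJs : (Matrix.of fun a b : Fin n => if (b : ℕ) = (a : ℕ) + s then (1 : ℂ) else 0) ∈ W)
    (hY : (Matrix.of fun a b : Fin n => if (a : ℕ) = (b : ℕ) + s then c b else 0) ∈ W)
    (hq : ∀ b : Fin n, ∀ hb : (b : ℕ) + 2 * s < n, c ⟨(b : ℕ) + s, by omega⟩ * c b = 0) :
    ∀ a : Fin n, (a : ℕ) + s < n → c a = 0 := by
  intro a ha
  have h := pair_eq_zero_of_isNilpotent_band hs (fun _ => (1 : ℂ)) c hq (hW _ (W.add_mem hJs hY)) a ha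
  simpa using h

/-! ## The support count of LEMMA R-a -/

/-- **Support count.**  `P, N ≤ ℂ^{N₀}`; `S` = a finite set of coordinates containing the support of every member of `N` and some coordinate; every
`p ∈ P` vanishes on `S`; every `q ∈ N` has zero coordinate sum; and `N₀ ≤ dim P + dim N + 1`.  Then every zero-sum vector supported on `S` lies in `N`.
[memo §2 (i) «L_s = Z_S»; this seat] -/
theorem zeroSum_mem_of_count {N₀ : ℕ} (P N : Submodule ℂ (Fin N₀ → ℂ)) (S : Finset (Fin N₀)) (hS : S.Nonempty)
    (hP : ∀ p ∈ P, ∀ i ∈ S, p i = 0) (hNsupp : ∀ q ∈ N, ∀ i, i ∉ S → q i = 0) (hNsum : ∀ q ∈ N, ∑ i, q i = 0)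
    (hcnt : N₀ ≤ Module.finrank ℂ P + Module.finrank ℂ N + 1)
    (v : Fin N₀ → ℂ) (hvsupp : ∀ i, i ∉ S → v i = 0) (hvsum : ∑ i, v i = 0) : v ∈ N := by
  classical
  -- `K` = vectors vanishing on `S`, `Z` = zero-sum vectors supported on `S`, `H` = vectors with zero sum over `S`
  let K : Submodule ℂ (Fin N₀ → ℂ) := ⨅ i ∈ S, LinearMap.ker (LinearMap.proj i)
  let Z : Submodule ℂ (Fin N₀ → ℂ) := (⨅ i ∈ Sᶜ, LinearMap.ker (LinearMap.proj i)) ⊓ LinearMap.ker (∑ i, LinearMap.proj i)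
  let H : Submodule ℂ (Fin N₀ → ℂ) := LinearMap.ker (∑ i ∈ S, (LinearMap.proj i : (Fin N₀ → ℂ) →ₗ[ℂ] ℂ))
  have memK : ∀ w, w ∈ K ↔ ∀ i ∈ S, w i = 0 := fun w => by
    simp only [K, Submodule.mem_iInf, LinearMap.mem_ker, LinearMap.coe_proj, Function.eval]
  have memZ : ∀ w, w ∈ Z ↔ (∀ i, i ∉ S → w i = 0) ∧ ∑ i, w i = 0 := fun w => by
    simp only [Z, Submodule.mem_inf, Submodule.mem_iInf, LinearMap.mem_ker, LinearMap.coe_proj, Function.eval, Finset.mem_compl,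
      LinearMap.coe_sum, Finset.sum_apply]
  have memH : ∀ w, w ∈ H ↔ ∑ i ∈ S, w i = 0 := fun w => by
    simp only [H, LinearMap.mem_ker, LinearMap.coe_sum, Finset.sum_apply, LinearMap.coe_proj, Function.eval]
  have hKH : K ≤ H := fun w hw => by
    rw [memH]; rw [memK] at hw
    exact Finset.sum_eq_zero fun i hi => hw i hi
  have hZH : Z ≤ H := fun w hw => by
    rw [memH]; rw [memZ] at hw
    have h := hw.2
    rw [← Finset.sum_add_sum_compl S] at h
    rw [Finset.sum_eq_zero (s := Sᶜ) (fun i hi => hw.1 i (Finset.mem_compl.1 hi)), add_zero] at h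
    exact h
  have hKZ : K ⊓ Z = ⊥ := by
    rw [eq_bot_iff]
    intro w hw
    rw [Submodule.mem_inf, memK, memZ] at hw
    rw [Submodule.mem_bot]
    funext i
    by_cases hi : i ∈ S
    · exact hw.1 i hi
    · exact hw.2.1 i hi
  have hHlt : H < ⊤ := by
    obtain ⟨i₀, hi₀⟩ := hS
    refine lt_top_iff_ne_top.2 fun hH => ?_
    have hmem : (Pi.single i₀ (1 : ℂ) : Fin N₀ → ℂ) ∈ H := by rw [hH]; exact Submodule.mem_top
    rw [memH, Finset.sum_eq_single i₀] at hmem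
    · simp at hmem
    · intro j _ hj; rw [Pi.single_apply, if_neg hj]
    · intro h; exact absurd hi₀ h
  have hHdim : Module.finrank ℂ H + 1 ≤ N₀ := by
    have h := Submodule.finrank_lt (lt_top_iff_ne_top.1 hHlt)
    rw [Module.finrank_fin_fun] at h
    omega
  have hsum := Submodule.finrank_sup_add_finrank_inf_eq K Z
  rw [hKZ, finrank_bot, add_zero] at hsum
  have hsup : Module.finrank ℂ ↥(K ⊔ Z) ≤ Module.finrank ℂ H := Submodule.finrank_mono (sup_le hKH hZH)
  have hPK : P ≤ K := fun p hp => (memK p).2 (hP p hp)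
  have hNZ : N ≤ Z := fun q hq => (memZ q).2 ⟨hNsupp q hq, hNsum q hq⟩
  have h1 := Submodule.finrank_mono hPK
  have h2 := Submodule.finrank_mono hNZ
  have hNZeq : N = Z := Submodule.eq_of_le_of_finrank_eq hNZ (by omega)
  rw [hNZeq, memZ]
  exact ⟨hvsupp, hvsum⟩

/-! ## LEMMA R-a -/

/-- ★ **LEMMA R-a (kernel form): the deficient height cannot be the lowest weight `s ≥ 2`.**  Frame: graded nilpotent `W ∋ J` with the
diagonal maps `dp h`/`dm h`; at height `s`: zero sums on `N_s`, the count `n − s ≤ dim P_s + dim N_s + 1`; zero slack at height `1`;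
`T_{2s} ⊆ W` and `T_{s+1} ⊆ W` (units `E_{i,i+2s}`, `E_{i,i+s+1}`); and `N_s ≠ 0`.  Conclusion: `False`. [memo §2 LEMMA R-a; this seat] -/
theorem lemmaRa (W : Submodule ℂ (Matrix (Fin n) (Fin n) ℂ)) (hW : ∀ A ∈ W, IsNilpotent A)
    (hgr : ∀ A ∈ W, ∀ d : ℤ, (Matrix.of fun a b : Fin n => if (b : ℤ) - (a : ℤ) = d then A a b else 0) ∈ W)
    (dp dm : ∀ h : ℕ, Matrix (Fin n) (Fin n) ℂ →ₗ[ℂ] (Fin (n - h) → ℂ))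
    (hdp : ∀ h A (i : Fin (n - h)) (a b : Fin n), (a : ℕ) = i → (b : ℕ) = i + h → dp h A i = A a b)
    (hdm : ∀ h A (i : Fin (n - h)) (a b : Fin n), (a : ℕ) = i + h → (b : ℕ) = i → dm h A i = A a b)
    (hJ : (Matrix.of fun a b : Fin n => if (b : ℕ) = (a : ℕ) + 1 then (1 : ℂ) else 0) ∈ W)
    {s : ℕ} (hs : 2 ≤ s)
    (hN1 : ∀ q ∈ W.map (dm s), q ⬝ᵥ (fun _ => (1 : ℂ)) = 0)
    (hcnt : n - s ≤ Module.finrank ℂ (W.map (dp s)) + Module.finrank ℂ (W.map (dm s)) + 1)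
    (hPN1 : ∀ q ∈ W.map (dm 1), ∀ p ∈ W.map (dp 1), q ⬝ᵥ p = 0)
    (gsum1 : Module.finrank ℂ (W.map (dp 1)) + Module.finrank ℂ (W.map (dm 1)) = n - 1)
    (hT2s : ∀ i : ℕ, i + 2 * s < n → (Matrix.of fun a b : Fin n => if (a : ℕ) = i ∧ (b : ℕ) = i + 2 * s then (1 : ℂ) else 0) ∈ W)
    (hTs1 : ∀ i : ℕ, i + (s + 1) < n → (Matrix.of fun a b : Fin n => if (a : ℕ) = i ∧ (b : ℕ) = i + (s + 1) then (1 : ℂ) else 0) ∈ W)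
    (hne : W.map (dm s) ≠ ⊥) : False := by
  classical
  -- (T3): `q_{b+s} q_b = 0` on `N_s`; (P): `P_s` vanishes on the support of `N_s`
  have ext_dm : ∀ B ∈ W, (Matrix.of fun a b : Fin n => if (a : ℕ) = (b : ℕ) + s then
      (fun i : Fin n => if hi : (i : ℕ) < n - s then dm s B ⟨(i : ℕ), hi⟩ else 0) b else 0) ∈ W :=
    fun B hB => lower_band_mem W hgr s (dm s) (hdm s) B hB _ (fun i => by simp only [dif_pos (show (i : ℕ) < n - s from i.isLt)])
  have ext_dp : ∀ A ∈ W, (Matrix.of fun a b : Fin n => if (b : ℕ) = (a : ℕ) + s then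
      (fun i : Fin n => if hi : (i : ℕ) < n - s then dp s A ⟨(i : ℕ), hi⟩ else 0) a else 0) ∈ W :=
    fun A hA => upper_band_mem W hgr s (dp s) (hdp s) A hA _ (fun i => by simp only [dif_pos (show (i : ℕ) < n - s from i.isLt)])
  have hq : ∀ B ∈ W, ∀ b : Fin n, ∀ hb : (b : ℕ) + 2 * s < n,
      (fun i : Fin n => if hi : (i : ℕ) < n - s then dm s B ⟨(i : ℕ), hi⟩ else 0) ⟨(b : ℕ) + s, by omega⟩ *
      (fun i : Fin n => if hi : (i : ℕ) < n - s then dm s B ⟨(i : ℕ), hi⟩ else 0) b = 0 :=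
    fun B hB b hb => sq_eq_zero_of_unit_mem W hW s _ (b : ℕ) hb (hT2s b hb) (ext_dm B hB)
  have hpair : ∀ p ∈ W.map (dp s), ∀ q ∈ W.map (dm s), ∀ i : Fin (n - s), p i * q i = 0 := by
    rintro _ ⟨A, hA, rfl⟩ _ ⟨B, hB, rfl⟩ i
    have h := pair_eq_zero_of_isNilpotent_band (show 1 ≤ s by omega) _ _ (hq B hB) (hW _ (W.add_mem (ext_dp A hA) (ext_dm B hB)))
      ⟨(i : ℕ), by omega⟩ (by dsimp only; omega)
    simpa [dif_pos i.isLt] using h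
  -- the joint support `S` of `N_s` and the conclusion `Z_S ⊆ N_s`
  set S : Finset (Fin (n - s)) := Finset.univ.filter (fun i => ∃ q ∈ W.map (dm s), q i ≠ 0) with hSdef
  have memS : ∀ i, i ∈ S ↔ ∃ q ∈ W.map (dm s), q i ≠ 0 := fun i => by simp [hSdef]
  obtain ⟨q₀, hq₀N, hq₀⟩ := Submodule.exists_mem_ne_zero_of_ne_bot hne
  obtain ⟨a, ha⟩ : ∃ a, q₀ a ≠ 0 := by
    by_contra h; push Not at h; exact hq₀ (funext h)
  have hsum0 : ∀ q ∈ W.map (dm s), ∑ i, q i = 0 := fun q hq => by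
    have h := hN1 q hq; rwa [dotProduct, show (∑ i, q i * (fun _ : Fin (n - s) => (1 : ℂ)) i) = ∑ i, q i from
      Finset.sum_congr rfl fun i _ => mul_one _] at h
  obtain ⟨b, hb, hab⟩ : ∃ b, q₀ b ≠ 0 ∧ b ≠ a := by
    by_contra h; push Not at h
    have hs0 := hsum0 q₀ hq₀N
    rw [Finset.sum_eq_single a (fun j _ hj => by
      by_contra hj'; exact hj (h j hj')) (fun h' => absurd (Finset.mem_univ a) h')] at hs0
    exact ha hs0
  have haS : a ∈ S := (memS a).2 ⟨q₀, hq₀N, ha⟩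
  have hbS : b ∈ S := (memS b).2 ⟨q₀, hq₀N, hb⟩
  have hZ : ∀ v : Fin (n - s) → ℂ, (∀ i, i ∉ S → v i = 0) → ∑ i, v i = 0 → v ∈ W.map (dm s) :=
    zeroSum_mem_of_count (W.map (dp s)) (W.map (dm s)) S ⟨a, haS⟩
      (fun p hp i hi => by
        obtain ⟨q, hq, hqi⟩ := (memS i).1 hi
        have := hpair p hp q hq i
        exact (mul_eq_zero.1 this).resolve_right hqi)
      (fun q hq i hi => by by_contra h; exact hi ((memS i).2 ⟨q, hq, h⟩)) hsum0 hcnt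
  -- WLOG `a < b`; the vector `e_a − e_b ∈ N_s`
  wlog hlt : (a : ℕ) < (b : ℕ) generalizing a b
  · exact this b hb a ha (Ne.symm hab) hbS haS (by have : (a : ℕ) ≠ (b : ℕ) := fun e => hab (Fin.ext e).symm; omega)
  have hvN : (Pi.single a (1 : ℂ) - Pi.single b (1 : ℂ)) ∈ W.map (dm s) := by
    refine hZ _ (fun i hi => ?_) ?_
    · have hia : i ≠ a := fun e => hi (e ▸ haS)
      have hib : i ≠ b := fun e => hi (e ▸ hbS)
      simp [hia, hib]
    · simp [Finset.sum_sub_distrib]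
  obtain ⟨B, hB, hBe⟩ := hvN
  -- the lower band `L_s(c)`, `c = e_a − e_b` (as a vector on `Fin n`)
  have han : (a : ℕ) + s < n := by have := a.isLt; omega
  have hbn : (b : ℕ) + s < n := by have := b.isLt; omega
  set c : Fin n → ℂ := fun i => if (i : ℕ) = (a : ℕ) then 1 else if (i : ℕ) = (b : ℕ) then -1 else 0 with hcdef
  have hY : (Matrix.of fun p q : Fin n => if (p : ℕ) = (q : ℕ) + s then c q else 0) ∈ W := by
    refine lower_band_mem W hgr s (dm s) (hdm s) B hB c (fun i => ?_)
    rw [hBe, hcdef]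
    simp only [Pi.sub_apply, Pi.single_apply, Fin.ext_iff]
    by_cases hia : (i : ℕ) = (a : ℕ)
    · rw [if_pos hia, if_pos hia, if_neg (by omega)]; simp
    · rw [if_neg hia, if_neg hia]
      by_cases hib : (i : ℕ) = (b : ℕ)
      · rw [if_pos hib, if_pos hib]; simp
      · rw [if_neg hib, if_neg hib]; simp
  -- (T1): the window vector `C = 𝟙_{[a,a+s)} − 𝟙_{[b,b+s)}` has `L_1(C) ∈ W`
  have hC := window_lower_mem W hW hgr (dp 1) (dm 1) (hdp 1) (hdm 1) hPN1 gsum1 hJ s c hY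
  set C : Fin n → ℂ := fun k => ∑ i : Fin n, if (i : ℕ) ≤ (k : ℕ) ∧ (k : ℕ) < (i : ℕ) + s ∧ (i : ℕ) + s < n then c i else 0 with hCdef
  have hCk : ∀ k : Fin n, C k = (if (a : ℕ) ≤ (k : ℕ) ∧ (k : ℕ) < (a : ℕ) + s then (1 : ℂ) else 0) -
      (if (b : ℕ) ≤ (k : ℕ) ∧ (k : ℕ) < (b : ℕ) + s then (1 : ℂ) else 0) := by
    intro k
    rw [hCdef]; dsimp only
    have e : ∀ i : Fin n, (if (i : ℕ) ≤ (k : ℕ) ∧ (k : ℕ) < (i : ℕ) + s ∧ (i : ℕ) + s < n then c i else 0) =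
        (if (i : ℕ) = (a : ℕ) then (if (a : ℕ) ≤ (k : ℕ) ∧ (k : ℕ) < (a : ℕ) + s then (1 : ℂ) else 0) else 0) -
        (if (i : ℕ) = (b : ℕ) then (if (b : ℕ) ≤ (k : ℕ) ∧ (k : ℕ) < (b : ℕ) + s then (1 : ℂ) else 0) else 0) := by
      intro i
      rw [hcdef]; dsimp only
      by_cases hia : (i : ℕ) = (a : ℕ)
      · rw [if_pos hia, if_neg (show ¬ ((i : ℕ) = (b : ℕ)) by omega), sub_zero]
        simp only [hia, han, and_true]
        split_ifs <;> rfl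
      · rw [if_neg hia, if_neg hia, zero_sub]
        by_cases hib : (i : ℕ) = (b : ℕ)
        · rw [if_pos hib]; simp only [hib, hbn, and_true]
          split_ifs <;> simp
        · rw [if_neg hib, if_neg hib, neg_zero]; split_ifs <;> rfl
    rw [Finset.sum_congr rfl (fun i _ => e i), Finset.sum_sub_distrib, sum_ite_eq_val, sum_ite_eq_val, dif_pos (by omega), dif_pos (by omega)]
  -- CASE `b ≤ a + s`: the mixed word (T2) at `i = a`
  by_cases hD : (b : ℕ) ≤ (a : ℕ) + s
  · have has1 : (a : ℕ) + (s + 1) < n := by omega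
    have hE := hTs1 (a : ℕ) has1
    rw [unit_eq_upperBand] at hE
    have h := mixed_word W hW s _ c C hE hY hC
    rw [Finset.sum_eq_single ⟨(a : ℕ), by omega⟩ (fun i _ hi => by
        have : ¬ ((i : ℕ) = (a : ℕ)) := fun e => hi (Fin.ext e)
        simp [this]) (fun h' => absurd (Finset.mem_univ _) h')] at h
    simp only [dif_pos has1, if_true] at h
    rw [hCk, hCk] at h
    rw [hcdef] at h; dsimp only at h
    have e1 : ¬ ((a : ℕ) + 1 = (a : ℕ)) := by omega
    have e3 : ¬ ((b : ℕ) ≤ (a : ℕ) ∧ (a : ℕ) < (b : ℕ) + s) := by omega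
    have e4 : ¬ ((a : ℕ) ≤ (a : ℕ) + s ∧ (a : ℕ) + s < (a : ℕ) + s) := by omega
    have e5 : (b : ℕ) ≤ (a : ℕ) + s ∧ (a : ℕ) + s < (b : ℕ) + s := ⟨hD, by omega⟩
    have e6 : (a : ℕ) ≤ (a : ℕ) ∧ (a : ℕ) < (a : ℕ) + s := ⟨le_rfl, by omega⟩
    simp only [e1, e3, e4, e5, e6, if_true, if_false, and_self] at h
    by_cases hb1 : (a : ℕ) + 1 = (b : ℕ)
    · simp only [hb1, if_true] at h; norm_num at h
    · simp only [hb1, if_false] at h; norm_num at h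
  -- CASE `b > a + s`: `Σ C_k² + 2 Σ C_k C_{k+1} = 6s − 4 ≠ 0`
  · have hQ := sum_sq_add_two_mul_sum_eq_zero W hW 1 (fun _ => (1 : ℂ)) C hJ hC
    have hbn' : (b : ℕ) + s + 1 < n + 1 := by omega
    -- pointwise values
    have sq : ∀ k : Fin n, (if (k : ℕ) + 1 < n then (fun _ : Fin n => (1 : ℂ)) k * C k else 0) ^ 2 =
        (if (a : ℕ) ≤ (k : ℕ) ∧ (k : ℕ) < (a : ℕ) + s then (1 : ℂ) else 0) + (if (b : ℕ) ≤ (k : ℕ) ∧ (k : ℕ) < (b : ℕ) + s then (1 : ℂ) else 0) := by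
      intro k
      rw [hCk]
      split_ifs <;> first | (exfalso; omega) | norm_num
    have pr : ∀ k : Fin n, (if hk : (k : ℕ) + 2 * 1 < n then (fun _ : Fin n => (1 : ℂ)) k * C k *
        ((fun _ : Fin n => (1 : ℂ)) ⟨(k : ℕ) + 1, by omega⟩ * C ⟨(k : ℕ) + 1, by omega⟩) else 0) =
        (if (a : ℕ) ≤ (k : ℕ) ∧ (k : ℕ) < (a : ℕ) + (s - 1) then (1 : ℂ) else 0) +
        (if (b : ℕ) ≤ (k : ℕ) ∧ (k : ℕ) < (b : ℕ) + (s - 1) then (1 : ℂ) else 0) := by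
      intro k
      by_cases hk : (k : ℕ) + 2 * 1 < n
      · rw [dif_pos hk, hCk, hCk]
        dsimp only
        split_ifs <;> first | (exfalso; omega) | norm_num
      · rw [dif_neg hk]
        split_ifs <;> first | (exfalso; omega) | norm_num
    rw [Finset.sum_congr rfl (fun k _ => sq k), Finset.sum_congr rfl (fun k _ => pr k), Finset.sum_add_distrib, Finset.sum_add_distrib,
      sum_indicator_eq _ _ (by omega), sum_indicator_eq _ _ (by omega),
      sum_indicator_eq _ _ (by omega), sum_indicator_eq _ _ (by omega)] at hQ
    simp only [Nat.add_sub_cancel_left] at hQ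
    have e : ((s : ℕ) : ℂ) + (s : ℂ) + 2 * (((s - 1 : ℕ) : ℂ) + ((s - 1 : ℕ) : ℂ)) = ((6 * s - 4 : ℕ) : ℂ) := by
      have : (((s - 1 : ℕ) : ℂ)) = (s : ℂ) - 1 := by rw [Nat.cast_sub (by omega)]; simp
      rw [this, Nat.cast_sub (by omega)]; push_cast; ring
    rw [e] at hQ
    have : (6 * s - 4 : ℕ) = 0 := by exact_mod_cast hQ
    omega

end Summit.ValiantsHypothesis.ValiantsHypothesis.Theorems.GrenetZeon.HeavyTopThmCLemmaRa

end
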